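import Mathlib
import Literature.Computability.Complexity.CliqueCounting

/-!
# Crux `MonotoneSuffices` (stmt-PneNP-18026), line `Sketch` — density-shift rung, stub W3:
the likelihood-ratio price of an `r`-up-shift

The density-shift rung of line `Sketch` replaces an input `x` (an edge-indicator vector with
`N = C(n,2)` slots) by the up-shift `x ∨ 1_R` for a uniformly random `r`-subset `R` of the slots.
On the slice `#supp = m` the shifted law has density `2^r · C(m,r) / C(N,r)` with respect to the
uniform law, and on the slices `m ≤ min (N/2 + u) N` this density is at most
`(2m/N)^r ≤ (1 + 2u/N)^r ≤ exp (2ur/N)`.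

This file proves exactly that estimate, cleared of denominators on the left:

* `shiftRatio_cast_choose_le` — `C(m,r) ≤ C(N,r) · (m/N)^r` in `ℝ` for `m ≤ N`, `0 < N`
  (the real-cast form of `C(m,r) · N^r ≤ C(N,r) · m^r`,
  `Literature.Computability.Complexity.choose_mul_pow_le_choose_mul_pow`);
* `shiftRatio_two_mul_min_le` — `2 · min (N/2 + u) N ≤ N + 2u` (`N/2` is `Nat.div`);
* `shiftRatio_one_add_pow_le_exp` — `(1 + 2u/N)^r ≤ exp (2ur/N)`;
* `stub_shiftRatio` — the registered stub (W3):
  `2^r · C(min (N/2+u) N, r) ≤ C(N,r) · exp (2ur/N)` for `0 < N`.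
-/

set_option linter.dupNamespace false -- `Summit.PneNP.PneNP.…`: summit = sub-problem name (D-0017)

namespace Summit.PneNP.PneNP.Theorems.MonotoneSuffices.DensityShift

/-- **Ratio of binomial coefficients, real form.** For `m ≤ N` and `0 < N`,
`C(m,r) ≤ C(N,r) · (m/N)^r`, i.e. `C(m,r)/C(N,r) = ∏_{i<r} (m-i)/(N-i) ≤ (m/N)^r`. [folklore] -/
theorem shiftRatio_cast_choose_le {m N : ℕ} (hmN : m ≤ N) (hN : 0 < N) (r : ℕ) :
    ((m.choose r : ℕ) : ℝ) ≤ (N.choose r : ℝ) * ((m : ℝ) / N) ^ r := by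
  have h := Literature.Computability.Complexity.choose_mul_pow_le_choose_mul_pow hmN r
  have hNr : (0 : ℝ) < (N : ℝ) ^ r := by positivity
  rw [div_pow, ← mul_div_assoc, le_div_iff₀ hNr]
  exact_mod_cast h

/-- **The shifted slices stay below `N/2 + u`.** `2 · min (N/2 + u) N ≤ N + 2u`, because
`2 · (N/2) ≤ N` for natural-number division. [folklore] -/
theorem shiftRatio_two_mul_min_le (N u : ℕ) : 2 * min (N / 2 + u) N ≤ N + 2 * u :=
  calc 2 * min (N / 2 + u) N ≤ 2 * (N / 2 + u) := Nat.mul_le_mul_left 2 (min_le_left _ _)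
    _ ≤ N + 2 * u := by omega

/-- **Exponential bound on the per-slot price.** `(1 + 2u/N)^r ≤ exp (2ur/N)`, from
`1 + x ≤ exp x` and `(exp x)^r = exp (r x)`. [folklore] -/
theorem shiftRatio_one_add_pow_le_exp (N r u : ℕ) :
    (1 + 2 * (u : ℝ) / N) ^ r ≤ Real.exp (2 * (u : ℝ) * r / N) := by
  have h1 : 1 + 2 * (u : ℝ) / N ≤ Real.exp (2 * (u : ℝ) / N) := by
    have := Real.add_one_le_exp (2 * (u : ℝ) / N)
    linarith
  calc (1 + 2 * (u : ℝ) / N) ^ r ≤ (Real.exp (2 * (u : ℝ) / N)) ^ r :=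
        pow_le_pow_left₀ (by positivity) h1 r
    _ = Real.exp (2 * (u : ℝ) * r / N) := by
        rw [← Real.exp_nat_mul]
        congr 1
        ring

/-- **W3: the likelihood-ratio price of an `r`-shift on the slices `≤ N/2 + u`.**
For `0 < N` and `m = min (N/2 + u) N`, `2^r · C(m,r) ≤ C(N,r) · exp (2ur/N)`: indeed
`2^r C(m,r) ≤ C(N,r) (2m/N)^r`, `2m ≤ N + 2u`, and `(1 + 2u/N)^r ≤ exp (2ur/N)`. For `r > m`
the left-hand side vanishes and the bound is trivial (covered uniformly by the same chain).
[folklore] -/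
theorem stub_shiftRatio :
    ∀ (N r u : ℕ), 0 < N →
      (2 : ℝ) ^ r * ((min (N / 2 + u) N).choose r : ℝ) ≤
        (N.choose r : ℝ) * Real.exp (2 * (u : ℝ) * r / N) := by
  intro N r u hN
  have hmN : min (N / 2 + u) N ≤ N := min_le_right _ _
  have h2m : 2 * min (N / 2 + u) N ≤ N + 2 * u := shiftRatio_two_mul_min_le N u
  have hNpos : (0 : ℝ) < N := by exact_mod_cast hN
  have h1 : ((min (N / 2 + u) N).choose r : ℝ) ≤
      (N.choose r : ℝ) * ((min (N / 2 + u) N : ℕ) / (N : ℝ)) ^ r :=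
    shiftRatio_cast_choose_le hmN hN r
  have h2 : (2 : ℝ) * (min (N / 2 + u) N : ℕ) / N ≤ 1 + 2 * (u : ℝ) / N := by
    rw [div_le_iff₀ hNpos, add_mul, one_mul, div_mul_cancel₀ _ hNpos.ne']
    exact_mod_cast h2m
  have h3 : ((2 : ℝ) * (min (N / 2 + u) N : ℕ) / N) ^ r ≤ Real.exp (2 * (u : ℝ) * r / N) :=
    (pow_le_pow_left₀ (by positivity) h2 r).trans (shiftRatio_one_add_pow_le_exp N r u)
  calc (2 : ℝ) ^ r * ((min (N / 2 + u) N).choose r : ℝ)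
      ≤ (2 : ℝ) ^ r * ((N.choose r : ℝ) * ((min (N / 2 + u) N : ℕ) / (N : ℝ)) ^ r) :=
        mul_le_mul_of_nonneg_left h1 (by positivity)
    _ = (N.choose r : ℝ) * ((2 : ℝ) * (min (N / 2 + u) N : ℕ) / N) ^ r := by
        rw [mul_div_assoc, mul_pow]
        ring
    _ ≤ (N.choose r : ℝ) * Real.exp (2 * (u : ℝ) * r / N) :=
        mul_le_mul_of_nonneg_left h3 (by positivity)

end Summit.PneNP.PneNP.Theorems.MonotoneSuffices.DensityShift
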